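import Mathlib
import Literature.Analysis.FluidPDE.Tao2016AveragedNS.RenormalisedCascadeWaves
import Literature.Analysis.FluidPDE.Tao2016AveragedNS.BoundedEternalSolutions
import Summits.NavierStokesRegularity.NavierStokesRegularity.Theorems.TaoLadderRungTwoBreakNoSurvivingEternalViscBddOneWakeDyadicViscousCriticalSquaring
import Summits.NavierStokesRegularity.NavierStokesRegularity.Theorems.TaoLadderRungTwoBreakNoSurvivingEternalViscBddOneWakeDyadicViscousClassical

/-!
# Crux `TaoLadderRungTwoBreak.NoSurvivingEternalViscBddOne` (stmt-NavierStokesRegularity-20419), both split children (ρ0)/(ρ+) on the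
# DYADIC MEMBER, any covariant viscosity `ν̂ ≥ 0`: STERILISATION above a sub-critical shell WITHOUT the action clause; survivors and
# loud ladders have `sup_σ (W_n(σ))₀ ≥ Λ⁻¹` on EVERY shell

MODEL lattice ODEs only (Tao 2016 §1.2/§4, the viscous equation before Thm. 4.2, critical variables of §6.4); nothing here is a
statement about the Navier–Stokes equations; no stub, crux, rung or summit is proved (`--supports stmt-NavierStokesRegularity-20419`).
Sequel to `…WakeDyadicViscousCriticalSquaring` (squaring step `c_{n+1} ≤ Λc_n²`, ceiling transfer `K_{n+1} ≤ 2Λc_nK_n`, any `ν̂ ≥ 0`)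
on real shells `V_n ≥ 0` of `V̇_n = ΛV_{n-1}² − Λ⁻¹V_nV_{n+1} − ν̂(1+ε₀)^{2n}V_n`, type I, bounded near `0⁻` (no action clause);
`c_n = sup_{t<0}(-t)V_n(t)`.  The conclusion is read on `physWeight(1)^n V_n(t)² = wtEnergy_n(σ)` (tree `dyadic_crit_loud`) — the
quantity of BOTH forward (S₁)-survival and loudness.

* `eventually_quiet_of_subcritical_visc` — **STERILISATION**: ONE shell `n₀ ∈ ℤ` with `Λ c_{n₀} < 1` ⟹ for every level `s₀ > 0` all
  sufficiently high shells obey `physWeight(1)^n V_n(t)² < s₀` for ALL `t < 0` (the ceilings fall super-exponentially in ratio and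
  `physWeight(1) = (1+ε₀)^{-4} < 1`).
* `crit_floor_of_frequently_loud_visc` — a solution reaching a fixed level `s₀ > 0` on infinitely many shells (as every survivor and
  every loud ladder does) has `c_n ≥ Λ⁻¹` on EVERY shell `n ∈ ℤ`.
* BY NAME, any `ν̂ ≥ 0`: `dyadic_visc_survivor_shell_floor` — a uniformly bounded admissible eternal solution of `dyadicTable` with
  covariant viscosity `ν̂ ≥ 0` that is forward (S₁)-surviving has `sup_σ (W_n(σ))₀ ≥ Λ⁻¹ = (1+ε₀)^{-5/2}` on every shell — the objects
  K1ᵛ(1) must exclude; `dyadic_loudLadder_shell_floor` — the same for the LOUD LADDERS of (ρ+) `NoLoudLadder` (`ν̂ > 0`, every shell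
  reaching the dissipation-critical level `ν̂²/4096`).  The inviscid `dyadic_survivor_shell_floor` (`…WakeDyadicCriticalFloor`) is the
  case `ν̂ = 0`, there obtained through the action clause and the wake criterion; here neither is needed.

READING for ⟨20419⟩ (census of this hand): on the dyadic member the objects of BOTH split children sit at renormalised amplitude
`≥ Λ⁻¹` on every shell by the squaring mechanism alone (law + positivity + type I), eight times the tree's loud-everywhere level
`q₀ = 1/(8Λ)` (`…QuietPast`).  HONEST LABEL: elementary; (ρ0), (ρ+), ⟨20419⟩ and every NS statement remain OPEN; rung 0.
-/

noncomputable section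

namespace Summit.NavierStokesRegularity.NavierStokesRegularity.Theorems.NoSurvivingEternalViscBddOne.DyadicViscousCriticalFloor

open Filter Topology Set MeasureTheory
open Literature.Analysis.FluidPDE Literature.Analysis.FluidPDE.TaoCascade
open Summit.NavierStokesRegularity.NavierStokesRegularity.Theorems.NoSurvivingEternalViscBddOne.WakeCriterion
open Summit.NavierStokesRegularity.NavierStokesRegularity.Theorems.NoSurvivingEternalViscBddOne.DyadicViscousCriticalSquaring

variable {ε₀ νh : ℝ} {V : ℤ → ℝ → ℝ}

/-! ## Sterilisation: a sub-critical shell quiets every higher shell at every level -/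

/-- **STERILISATION, any `ν̂ ≥ 0` (no action clause).**  For a non-negative type-I solution of (vKP-crit) with shells bounded
near `0⁻`: if SOME shell `n₀ ∈ ℤ` has `(-t)V_{n₀}(t) ≤ c` for all `t < 0` with `Λc < 1`, then for every level `s₀ > 0` there is
`N` such that every shell `n ≥ N` obeys `physWeight(1)^n V_n(t)² < s₀` for ALL `t < 0` (`= wtEnergy_n(σ) < s₀` at all log-times):
the ceilings `K_n = sup V_n` satisfy `K_{n+1} ≤ 2Λc_nK_n` with `c_n ≤ Λ⁻¹(Λc)^{2^{n-n₀}}`, so they are eventually non-increasing,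
and `physWeight(1) = (1+ε₀)^{-4} < 1`.
[cite: Tao2016AveragedNS, §1.2, §4 Thm. 4.2 (statement shape) and the viscous equation before it, §6.4; elementary] -/
theorem eventually_quiet_of_subcritical_visc (hε : 0 < ε₀) (hν : 0 ≤ νh)
    (hV : ∀ (n : ℤ) (t : ℝ), t < 0 →
      HasDerivAt (V n) (bigLam ε₀ * V (n - 1) t ^ 2 - (bigLam ε₀)⁻¹ * (V n t * V (n + 1) t)
        - νh * (1 + ε₀) ^ ((2 : ℝ) * n) * V n t) t)
    (hpos : ∀ (n : ℤ) (t : ℝ), t < 0 → 0 ≤ V n t)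
    (hI : ∃ C : ℝ, ∀ (n : ℤ) (t : ℝ), t < 0 → V n t ≤ C / (-t))
    (hbd : ∀ n : ℤ, ∃ t₀ : ℝ, t₀ < 0 ∧ ∃ P : ℝ, ∀ t : ℝ, t₀ ≤ t → t < 0 → |V n t| ≤ P)
    {n₀ : ℤ} {c : ℝ} (hc : ∀ t : ℝ, t < 0 → (-t) * V n₀ t ≤ c) (hsub : bigLam ε₀ * c < 1)
    {s₀ : ℝ} (hs₀ : 0 < s₀) :
    ∃ N : ℕ, ∀ n : ℕ, N ≤ n → ∀ t : ℝ, t < 0 → physWeight 1 ε₀ ^ n * V n t ^ 2 < s₀ := by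
  have hΛ : 0 < bigLam ε₀ := bigLam_pos (by linarith)
  have hc0 : 0 ≤ c := by
    have h := hc (-1) (by norm_num)
    have h0 : 0 ≤ V n₀ (-1) := hpos n₀ (-1) (by norm_num)
    nlinarith
  have hx0 : 0 ≤ bigLam ε₀ * c := by positivity
  -- a sub-critical shell with non-negative index `m`
  obtain ⟨m, hm⟩ : ∃ m : ℕ, ∀ t : ℝ, t < 0 → (-t) * V (m : ℤ) t ≤ c := by
    rcases le_or_gt 0 n₀ with h0 | h0
    · refine ⟨n₀.toNat, ?_⟩
      rw [Int.toNat_of_nonneg h0]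
      exact hc
    · refine ⟨0, fun t ht => ?_⟩
      have hj : n₀ + (((-n₀).toNat : ℕ) : ℤ) = ((0 : ℕ) : ℤ) := by
        rw [Int.toNat_of_nonneg (by linarith)]; push_cast; ring
      have h := crit_iterate_le_visc hε hν hV hpos hI n₀ hc (-n₀).toNat t ht
      rw [hj] at h
      refine h.trans ?_
      have hp : (bigLam ε₀ * c) ^ (2 ^ (-n₀).toNat) ≤ bigLam ε₀ * c :=
        pow_le_of_le_one hx0 hsub.le (Nat.two_pow_pos _).ne'
      calc (bigLam ε₀)⁻¹ * (bigLam ε₀ * c) ^ (2 ^ (-n₀).toNat)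
          ≤ (bigLam ε₀)⁻¹ * (bigLam ε₀ * c) := mul_le_mul_of_nonneg_left hp (inv_nonneg.2 hΛ.le)
        _ = c := by rw [inv_mul_cancel_left₀ hΛ.ne']
  -- a ceiling for shell `m`
  obtain ⟨C, hC⟩ := hI
  obtain ⟨K₀, hK₀⟩ : ∃ K₀ : ℝ, ∀ t : ℝ, t < 0 → V (m : ℤ) t ≤ K₀ := by
    obtain ⟨t₀, ht₀, P, hP⟩ := hbd (m : ℤ)
    refine ⟨max P (C / (-t₀)), fun t ht => ?_⟩
    rcases le_or_gt t₀ t with h1 | h1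
    · exact ((le_abs_self _).trans (hP t h1 ht)).trans (le_max_left _ _)
    · have hnt : 0 < -t := by linarith
      have hnt₀ : 0 < -t₀ := by linarith
      have h2 : C / (-t) ≤ C / (-t₀) := by
        rcases le_or_gt 0 C with hC0 | hC0
        · exact div_le_div_of_nonneg_left hC0 hnt₀ (by linarith)
        · have : V (m : ℤ) t ≤ C / (-t) := hC _ t ht
          have : 0 ≤ V (m : ℤ) t := hpos _ t ht
          have : C / (-t) < 0 := div_neg_of_neg_of_pos hC0 hnt
          linarith
      exact ((hC _ t ht).trans h2).trans (le_max_right _ _)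
  -- the ceiling sequence above `m`
  set cj : ℕ → ℝ := fun j => (bigLam ε₀)⁻¹ * (bigLam ε₀ * c) ^ (2 ^ j) with hcj
  set Kseq : ℕ → ℝ := fun j => Nat.rec K₀ (fun i Ki => 2 * bigLam ε₀ * cj i * Ki) j with hKseq
  have hKsucc : ∀ j, Kseq (j + 1) = 2 * bigLam ε₀ * cj j * Kseq j := fun j => rfl
  have hK : ∀ j : ℕ, ∀ t : ℝ, t < 0 → V ((m : ℤ) + (j : ℕ)) t ≤ Kseq j := by
    intro j
    induction j with
    | zero => intro t ht; simpa [hKseq] using hK₀ t ht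
    | succ i ih =>
      intro t ht
      have hci := crit_iterate_le_visc hε hν hV hpos ⟨C, hC⟩ (m : ℤ) hm i
      have h := sup_succ_le_crit_visc hε hν hV hpos ⟨C, hC⟩ ((m : ℤ) + (i : ℕ)) hci ih ht
      have e1 : (m : ℤ) + (i : ℕ) + 1 = (m : ℤ) + ((i + 1 : ℕ) : ℤ) := by push_cast; ring
      rw [e1] at h
      rw [hKsucc]
      exact h
  have hK0 : ∀ j, 0 ≤ Kseq j := fun j => (hpos _ (-1) (by norm_num)).trans (hK j (-1) (by norm_num))
  -- the factor `2Λ cj j` is eventually `≤ 1`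
  have hgeo : Tendsto (fun j : ℕ => 2 * (bigLam ε₀ * c) ^ j) atTop (𝓝 0) := by
    simpa using (tendsto_pow_atTop_nhds_zero_of_lt_one hx0 hsub).const_mul (2 : ℝ)
  obtain ⟨J, hJ⟩ : ∃ J : ℕ, ∀ j, J ≤ j → 2 * (bigLam ε₀ * c) ^ j ≤ 1 := by
    have hev := hgeo.eventually (eventually_lt_nhds zero_lt_one)
    obtain ⟨J, hJ⟩ := eventually_atTop.1 hev
    exact ⟨J, fun j hj => (hJ j hj).le⟩
  have hfac : ∀ j, J ≤ j → 2 * bigLam ε₀ * cj j ≤ 1 := by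
    intro j hj
    have hp : (bigLam ε₀ * c) ^ (2 ^ j) ≤ (bigLam ε₀ * c) ^ j :=
      pow_le_pow_of_le_one hx0 hsub.le (Nat.lt_two_pow_self).le
    have e : 2 * bigLam ε₀ * cj j = 2 * (bigLam ε₀ * c) ^ (2 ^ j) := by
      simp only [hcj]; field_simp
    rw [e]
    exact (mul_le_mul_of_nonneg_left hp (by norm_num : (0 : ℝ) ≤ 2)).trans (hJ j hj)
  -- hence the ceilings are bounded by `Kseq J` beyond `J`
  have hanti : ∀ j, J ≤ j → Kseq j ≤ Kseq J := by
    intro j hj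
    refine Nat.le_induction le_rfl (fun k hk ih => ?_) j hj
    rw [hKsucc]
    have h2 : 2 * bigLam ε₀ * cj k * Kseq k ≤ 1 * Kseq k := mul_le_mul_of_nonneg_right (hfac k hk) (hK0 k)
    linarith
  -- the weight
  have hw : physWeight 1 ε₀ = ((1 + ε₀) ^ 4)⁻¹ := by
    unfold physWeight
    rw [Real.rpow_one]
    field_simp
  have hw0 : 0 ≤ physWeight 1 ε₀ := by rw [hw]; positivity
  have hw1 : physWeight 1 ε₀ < 1 := by
    rw [hw]
    exact inv_lt_one_of_one_lt₀ (one_lt_pow₀ (by linarith) (by norm_num))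
  have hlim : Tendsto (fun n : ℕ => Kseq J ^ 2 * physWeight 1 ε₀ ^ n) atTop (𝓝 0) := by
    simpa using (tendsto_pow_atTop_nhds_zero_of_lt_one hw0 hw1).const_mul (Kseq J ^ 2)
  obtain ⟨N₁, hN₁⟩ := eventually_atTop.1 (hlim.eventually (eventually_lt_nhds hs₀))
  refine ⟨max N₁ (m + J), fun n hn t ht => ?_⟩
  have hn1 : N₁ ≤ n := le_trans (le_max_left _ _) hn
  have hn2 : m + J ≤ n := le_trans (le_max_right _ _) hn
  have hidx : ((n : ℕ) : ℤ) = (m : ℤ) + ((n - m : ℕ) : ℤ) := by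
    have : m ≤ n := le_trans (Nat.le_add_right m J) hn2
    push_cast [Nat.cast_sub this]; ring
  have hVle : V n t ≤ Kseq J := by
    have h := hK (n - m) t ht
    rw [← hidx] at h
    exact h.trans (hanti (n - m) (by omega))
  have hV0 : 0 ≤ V n t := hpos _ t ht
  have hsq : V n t ^ 2 ≤ Kseq J ^ 2 := pow_le_pow_left₀ hV0 hVle 2
  calc physWeight 1 ε₀ ^ n * V n t ^ 2 ≤ physWeight 1 ε₀ ^ n * Kseq J ^ 2 :=
        mul_le_mul_of_nonneg_left hsq (pow_nonneg hw0 n)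
    _ = Kseq J ^ 2 * physWeight 1 ε₀ ^ n := mul_comm _ _
    _ < s₀ := hN₁ n hn1

/-- **A SOLUTION REACHING A FIXED LEVEL ON INFINITELY MANY SHELLS IS CRITICAL ON EVERY SHELL, any `ν̂ ≥ 0`.**  If for some
`s₀ > 0` and infinitely many shells `n` there is `t < 0` with `physWeight(1)^n V_n(t)² ≥ s₀` (every forward (S₁)-survivor and every
loud ladder does this), then every shell `n ∈ ℤ` has critical amplitude `≥ Λ⁻¹`: `(-t)V_n(t) ≤ c` for all `t < 0` forces `c ≥ Λ⁻¹`.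
[cite: Tao2016AveragedNS, §1.2, §4 Thm. 4.2 (statement shape) and the viscous equation before it, §6.4; elementary] -/
theorem crit_floor_of_frequently_loud_visc (hε : 0 < ε₀) (hν : 0 ≤ νh)
    (hV : ∀ (n : ℤ) (t : ℝ), t < 0 →
      HasDerivAt (V n) (bigLam ε₀ * V (n - 1) t ^ 2 - (bigLam ε₀)⁻¹ * (V n t * V (n + 1) t)
        - νh * (1 + ε₀) ^ ((2 : ℝ) * n) * V n t) t)
    (hpos : ∀ (n : ℤ) (t : ℝ), t < 0 → 0 ≤ V n t)
    (hI : ∃ C : ℝ, ∀ (n : ℤ) (t : ℝ), t < 0 → V n t ≤ C / (-t))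
    (hbd : ∀ n : ℤ, ∃ t₀ : ℝ, t₀ < 0 ∧ ∃ P : ℝ, ∀ t : ℝ, t₀ ≤ t → t < 0 → |V n t| ≤ P)
    {s₀ : ℝ} (hs₀ : 0 < s₀)
    (hfreq : ∀ N : ℕ, ∃ n : ℕ, N ≤ n ∧ ∃ t : ℝ, t < 0 ∧ s₀ ≤ physWeight 1 ε₀ ^ n * V n t ^ 2)
    (n : ℤ) {c : ℝ} (hc : ∀ t : ℝ, t < 0 → (-t) * V n t ≤ c) : (bigLam ε₀)⁻¹ ≤ c := by
  have hΛ : 0 < bigLam ε₀ := bigLam_pos (by linarith)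
  by_contra h
  have hsub : bigLam ε₀ * c < 1 := by
    have h' : c < (bigLam ε₀)⁻¹ := not_le.1 h
    calc bigLam ε₀ * c < bigLam ε₀ * (bigLam ε₀)⁻¹ := mul_lt_mul_of_pos_left h' hΛ
      _ = 1 := mul_inv_cancel₀ hΛ.ne'
  obtain ⟨N, hN⟩ := eventually_quiet_of_subcritical_visc hε hν hV hpos hI hbd hc hsub hs₀
  obtain ⟨k, hk, t, ht, hge⟩ := hfreq N
  exact absurd (hN k hk t ht) (not_lt.2 hge)

/-! ## By name on the dyadic member, any covariant viscosity -/

/-- Component `0` is bounded by the Euclidean norm in `ℝ⁴`. [folklore] -/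
theorem apply_zero_le_norm (x : Em 4) : x 0 ≤ ‖x‖ := by
  have h1 : |x 0| ≤ ‖x‖ := by
    have h := EuclideanSpace.norm_eq x
    calc |x 0| = Real.sqrt (|x 0| ^ 2) := by rw [Real.sqrt_sq (abs_nonneg _)]
      _ = Real.sqrt (‖x 0‖ ^ 2) := by rw [Real.norm_eq_abs]
      _ ≤ Real.sqrt (∑ i, ‖x i‖ ^ 2) := by
          refine Real.sqrt_le_sqrt ?_
          exact Finset.single_le_sum (f := fun i => ‖x i‖ ^ 2) (fun i _ => by positivity)
            (Finset.mem_univ (0 : Fin 4))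
      _ = ‖x‖ := h.symm
  exact (le_abs_self _).trans h1

/-- **SURVIVORS ARE CRITICAL ON EVERY SHELL, any `ν̂ ≥ 0` (by name).**  A uniformly bounded admissible eternal solution `W` of the
dyadic member `dyadicTable` with covariant viscosity `ν̂ ≥ 0` (`IsEternalVisc ε₀ ν̂ dyadicTable W`, `UniformBound W`) that is forward
(S₁)-surviving has, on EVERY shell `n ∈ ℤ`, `sup_σ (W_n(σ))₀ ≥ Λ⁻¹ = (1+ε₀)^{-5/2}`: every `c` with `(W_n(σ))₀ ≤ c` for all `σ`
satisfies `c ≥ Λ⁻¹`.  (Critical variables `V_n(t) = (-t)⁻¹(W_n(-log(-t)))₀`, tree dictionary `dyadic_crit_*_visc`; a survival event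
`c₀ ≤ wtEnergy_n(σ)` is `c₀ ≤ physWeight(1)^n V_n(t)²` at `t = -e^{-σ}`, tree `dyadic_crit_loud`.)
[cite: Tao2016AveragedNS, §1.2, §4 Thm. 4.2 (statement shape) and the viscous equation before it, §6.4; this file + tree dictionary] -/
theorem dyadic_visc_survivor_shell_floor (hε : 0 < ε₀) (hν : 0 ≤ νh) {W : ℤ → ℝ → Em 4}
    (hW : IsEternalVisc ε₀ νh dyadicTable W) (hU : UniformBound W) (hS : EternalSurvivingFwd 1 ε₀ W)
    (n : ℤ) {c : ℝ} (hc : ∀ σ : ℝ, W n σ 0 ≤ c) : (bigLam ε₀)⁻¹ ≤ c := by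
  obtain ⟨B, hB⟩ := hU
  obtain ⟨c₀, hc₀, hfl⟩ := hS
  -- the hypotheses of the classical form for the critical variable
  have hpos : ∀ (k : ℤ) (t : ℝ), t < 0 → 0 ≤ (-t)⁻¹ * W k (-Real.log (-t)) 0 :=
    fun k t ht => dyadic_crit_nonneg_visc hε hW k ht
  have hI : ∃ C : ℝ, ∀ (k : ℤ) (t : ℝ), t < 0 → (-t)⁻¹ * W k (-Real.log (-t)) 0 ≤ C / (-t) := by
    refine ⟨B, fun k t ht => ?_⟩
    have hnt : 0 < -t := by linarith
    rw [div_eq_inv_mul]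
    exact mul_le_mul_of_nonneg_left ((apply_zero_le_norm _).trans (hB k _)) (inv_nonneg.2 hnt.le)
  have hfreq : ∀ N : ℕ, ∃ k : ℕ, N ≤ k ∧ ∃ t : ℝ, t < 0 ∧
      c₀ / 2 ≤ physWeight 1 ε₀ ^ k * ((-t)⁻¹ * W k (-Real.log (-t)) 0) ^ 2 := by
    intro N
    obtain ⟨k, hk, σ, _, hle⟩ := hfl N
    have hlt : ∃ σ' : ℝ, c₀ / 2 < wtEnergy ε₀ W k σ' := ⟨σ, by unfold wtEnergy; linarith⟩
    obtain ⟨t, ht, hlt'⟩ := dyadic_crit_loud hε hW hlt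
    exact ⟨k, hk, t, ht, hlt'.le⟩
  refine crit_floor_of_frequently_loud_visc (V := fun k t => (-t)⁻¹ * W k (-Real.log (-t)) 0) hε hν
    (fun k t ht => dyadic_crit_hasDerivAt_visc hW k ht) hpos hI (fun k => dyadic_crit_bdd_visc hε hW k)
    (half_pos hc₀) hfreq n fun t ht => ?_
  have hnt : (-t) ≠ 0 := by
    have : 0 < -t := by linarith
    exact this.ne'
  show (-t) * ((-t)⁻¹ * W n (-Real.log (-t)) 0) ≤ c
  rw [mul_inv_cancel_left₀ hnt]
  exact hc _

/-- **LOUD LADDERS ARE CRITICAL ON EVERY SHELL (by name; the objects of (ρ+) `NoLoudLadder` on the dyadic member).**  A uniformly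
bounded admissible eternal solution of `dyadicTable` with covariant viscosity `ν̂ > 0` in which EVERY shell `n ≥ 0` reaches the
dissipation-critical level (`∀ s₀ < ν̂²/4096, ∃ σ, s₀ < wtEnergy_n(σ)`) has `sup_σ (W_n(σ))₀ ≥ Λ⁻¹` on every shell `n ∈ ℤ`.
[cite: Tao2016AveragedNS, §1.2, §4 Thm. 4.2 (statement shape) and the viscous equation before it, §6.4; this file + tree dictionary] -/
theorem dyadic_loudLadder_shell_floor (hε : 0 < ε₀) (hν : 0 < νh) {W : ℤ → ℝ → Em 4}
    (hW : IsEternalVisc ε₀ νh dyadicTable W) (hU : UniformBound W)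
    (hloud : ∀ n₀ : ℕ, ∀ s₀ : ℝ, s₀ < νh ^ 2 / 4096 → ∃ σ : ℝ, s₀ < wtEnergy ε₀ W n₀ σ)
    (n : ℤ) {c : ℝ} (hc : ∀ σ : ℝ, W n σ 0 ≤ c) : (bigLam ε₀)⁻¹ ≤ c := by
  obtain ⟨B, hB⟩ := hU
  have hpos : ∀ (k : ℤ) (t : ℝ), t < 0 → 0 ≤ (-t)⁻¹ * W k (-Real.log (-t)) 0 :=
    fun k t ht => dyadic_crit_nonneg_visc hε hW k ht
  have hI : ∃ C : ℝ, ∀ (k : ℤ) (t : ℝ), t < 0 → (-t)⁻¹ * W k (-Real.log (-t)) 0 ≤ C / (-t) := by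
    refine ⟨B, fun k t ht => ?_⟩
    have hnt : 0 < -t := by linarith
    rw [div_eq_inv_mul]
    exact mul_le_mul_of_nonneg_left ((apply_zero_le_norm _).trans (hB k _)) (inv_nonneg.2 hnt.le)
  have hs₀ : 0 < νh ^ 2 / 8192 := by positivity
  have hfreq : ∀ N : ℕ, ∃ k : ℕ, N ≤ k ∧ ∃ t : ℝ, t < 0 ∧
      νh ^ 2 / 8192 ≤ physWeight 1 ε₀ ^ k * ((-t)⁻¹ * W k (-Real.log (-t)) 0) ^ 2 := by
    intro N
    have hlt : νh ^ 2 / 8192 < νh ^ 2 / 4096 := by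
      have : 0 < νh ^ 2 := by positivity
      linarith
    obtain ⟨t, ht, hlt'⟩ := dyadic_crit_loud hε hW (hloud N _ hlt)
    exact ⟨N, le_rfl, t, ht, hlt'.le⟩
  refine crit_floor_of_frequently_loud_visc (V := fun k t => (-t)⁻¹ * W k (-Real.log (-t)) 0) hε hν.le
    (fun k t ht => dyadic_crit_hasDerivAt_visc hW k ht) hpos hI (fun k => dyadic_crit_bdd_visc hε hW k)
    hs₀ hfreq n fun t ht => ?_
  have hnt : (-t) ≠ 0 := by
    have : 0 < -t := by linarith
    exact this.ne'
  show (-t) * ((-t)⁻¹ * W n (-Real.log (-t)) 0) ≤ c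
  rw [mul_inv_cancel_left₀ hnt]
  exact hc _

end Summit.NavierStokesRegularity.NavierStokesRegularity.Theorems.NoSurvivingEternalViscBddOne.DyadicViscousCriticalFloor

end
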